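import Summits.NavierStokesRegularity.NavierStokesRegularity.Theorems.NoOverheating.Negative.LadderLimitExposed
import Summits.NavierStokesRegularity.NavierStokesRegularity.Theorems.NoOverheating.Negative.TransversalAxisKinematics
import Literature.Analysis.FluidPDE.WholeSpaceIBP
import HarnessLib

/-!
# Census strata (S33)/(S34): no admissible window sequence is ASYMPTOTICALLY RADIAL, and none is
# ASYMPTOTICALLY UNIDIRECTIONAL (velocity parallel to one fixed line in the limit); no rung profile
# has a radial slice
# (route `AngularGalerkinLadder`, crux K2 `NoOverheating`; census strata, Negative lane, theorems only)

Refuter seat (ns-blowup-refuter g19), kernel census for crux K2 `NoOverheating`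
(stmt-NavierStokesRegularity-19960) of route `AngularGalerkinLadder`, Negative lane (`--supports`).
No definition, no named fact, no item verdict moves; nothing is asserted about Navier–Stokes — two
KINEMATIC consequences of incompressibility alone, read on the ladder limit (KJ-33a
`exists_ladderLimit_typeI`: along an admissible window sequence — common `C₀`, `[cmin, cmax]`,
floor `δ > 0`, defect sizes `εₙ → 0` — a subsequence converges pointwise on `t < 0` to a Type-I
ancient mild solution `v` with divergence-free `C^∞` slices, Type-I decay
`‖v(t,x)‖ ≤ C₀/(‖x‖ + √(−t))` and the inherited floor `δ ≤ ‖v(−1, x₀)‖`).  This module imports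
`LadderLimitExposed`, the route-free kinematics module `TransversalAxisKinematics` and Literature
only (no `Theses` import).

## §1 A `C¹` divergence-free RADIAL field on `ℝ³` is zero (`eq_zero_of_radial_of_isDivFree`)

`v` radial means `‖x‖² v(x) = ⟪v(x), x⟫ x` (i.e. `v(x) ∈ ℝx` for `x ≠ 0`).  Put `h := ⟪v, x⟫`, so
`‖x‖² v = h x` as functions.  Taking divergences (`div (c T) = c div T + Dc[T]`, `div x = 3`,
`D‖x‖²[w] = 2⟪x, w⟫`, `div v = 0`): `2 h = 3 h + Dh[x]`, the Euler identity `Dh(x)[x] = −h(x)`.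
Along every ray, `k(r) := r h(r y)` has `k′(r) = h(ry) + Dh(ry)[ry] = 0` and `k(0) = 0`, so
`h ≡ 0`, hence `‖x‖² v(x) = 0`: `v = 0` off the origin, and at the origin by continuity.  (The flux
reading: `v = f(x) x` with `div v = r f′ + 3 f = 0` forces `f = c r⁻³`, singular unless `c = 0`.)

## §2 A decaying `C²` divergence-free field PARALLEL TO ONE LINE is zero

If `‖e‖² v(x) = ⟪v(x), e⟫ e` (`e ≠ 0`; in coordinates with `e = e₃`: `v = (0, 0, v₃)` — a
"parallel" or unidirectional flow) and `div v = 0`, then `∂ₑ v₃ = 0`, so `v` is invariant under the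
translation by `e` (`eq_of_parallel_of_isDivFree`, module `TransversalAxisKinematics`), and a field
with Type-I slice decay `‖v(x)‖ ≤ C/(‖x‖ + a)`, `a > 0`, whose norm does not decrease under a
non-zero translation vanishes (`eq_zero_of_decay_of_norm_le_norm_translate` — the `S = 1` case of
KJ-58's screw lemma `eq_zero_of_decay_of_norm_le_norm_screw`, re-proved here in five lines so that
this module does not import a route file).

## §3 On the ladder

* `rungProfile_slice_eq_zero_of_radial`, `not_nontrivial_rungProfile_of_radial`,
  `no_windowProfile_radialSlice` — a rung profile with a radial slice at some `t < 0` has that slice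
  `≡ 0`; a K1-witness (nontrivial rung profile) is nowhere-in-time radial; a window profile
  (`0 < δ ≤ ‖u(−1, x₀)‖`) has no radial slice at `t = −1`.  (The unidirectional profile-level
  statement is KJ-62's `rungProfile_slice_eq_zero_of_parallel`, not restated.)
* **(S33) `no_windowSequence_asymptoticallyRadial`**: `‖x‖² uₙ(−1, x) − ⟪uₙ(−1, x), x⟫ x → 0`
  pointwise (only the slice `t = −1` is used) is contradictory — the limit slice `v(−1)` is radial,
  `C^∞`, divergence free, hence `0`, against the floor; census form with `∀ t < 0`.
* **(S34) `no_windowSequence_asymptoticallyUnidirectional`**: for a fixed `e ≠ 0`,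
  `‖e‖² uₙ(−1, x) − ⟪uₙ(−1, x), e⟫ e → 0` pointwise is contradictory — the limit slice is parallel to
  `ℝe`, divergence free and Type-I decaying, hence `0`; census form with `∃ e ≠ 0, ∀ t < 0`.

LABEL: KERNEL, unconditional. WHAT THIS IS NOT: not Navier–Stokes evidence; no window sequence is
constructed; the EXACTLY unidirectional profile ((S15), KJ-62) and the transversal-bounded readings
are elsewhere; sequences that are radial / unidirectional only up to a moving frame, or only on a
bounded region, are untouched. References:
[cite: KochNadirashviliSereginSverak2009, Lemma 6.1 (limits of rescaled solutions), (1.6) (Type-I decay)];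
[cite: MajdaBertozziCUP2002, §1.1 (divergence, incompressibility)].
-/

noncomputable section

namespace Summit.NavierStokesRegularity.AngularGalerkinLadderRadialUnidirectionalLimitsExcluded

open Set Function Filter Topology
open Literature.Analysis Literature.Analysis.FluidPDE
open Summit.NavierStokesRegularity.FluidComputer Summit.NavierStokesRegularity.FluidComputer.AngularLadder
open Summit.NavierStokesRegularity.AngularGalerkinLadderLadderLimit
open Summit.NavierStokesRegularity.AngularGalerkinLadderTransversalAxisKinematics
open scoped RealInnerProductSpace ContDiff

/-! ### §1 Radial divergence-free fields vanish -/

section Kinematics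

variable {v : EuclideanSpace ℝ (Fin 3) → EuclideanSpace ℝ (Fin 3)} {e : EuclideanSpace ℝ (Fin 3)}

/-- **Euler identity for the radial coefficient.** If `v ∈ C¹` is divergence free and radial,
`‖x‖² v(x) = ⟪v(x), x⟫ x`, then `h := ⟪v, x⟫` satisfies `Dh(x)[x] = −h(x)` (take the divergence
of `‖x‖² v = h x`: `2h + ‖x‖² div v = 3h + Dh[x]`, with `div x = tr id = 3`). [folklore] -/
theorem fderiv_inner_self_apply_self_of_radial (hv : ContDiff ℝ 1 v)
    (hdiv : VectorCalculus.IsDivFree v)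
    (hrad : ∀ x, ‖x‖ ^ 2 • v x = ⟪v x, x⟫ • x) (x : EuclideanSpace ℝ (Fin 3)) :
    fderiv ℝ (fun y => ⟪v y, y⟫) x x = -⟪v x, x⟫ := by
  have hvd : Differentiable ℝ v := hv.differentiable one_ne_zero
  have hhd : Differentiable ℝ (fun y => ⟪v y, y⟫) := hvd.inner ℝ differentiable_id
  have hnd : DifferentiableAt ℝ (fun y : EuclideanSpace ℝ (Fin 3) => ‖y‖ ^ 2) x :=
    (hasStrictFDerivAt_norm_sq x).differentiableAt
  -- divergence of the left-hand side `‖y‖² • v y`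
  have h1 : VectorCalculus.divergence (fun y => ‖y‖ ^ 2 • v y) x = 2 * ⟪v x, x⟫ := by
    rw [divergence_smul_apply hnd (hvd x), hdiv x, mul_zero, zero_add, real_inner_comm, gradient,
      InnerProductSpace.toDual_symm_apply, (hasStrictFDerivAt_norm_sq x).hasFDerivAt.fderiv]
    simp [two_smul, two_mul, real_inner_comm]
  -- divergence of the identity field: `tr id = 3`
  have h3 : VectorCalculus.divergence (fun y : EuclideanSpace ℝ (Fin 3) => y) x = 3 := by
    rw [VectorCalculus.divergence, fderiv_fun_id]
    have h := LinearMap.trace_id ℝ (EuclideanSpace ℝ (Fin 3))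
    rw [finrank_euclideanSpace_fin] at h
    exact_mod_cast h
  -- divergence of the right-hand side `⟪v y, y⟫ • y`
  have h2 : VectorCalculus.divergence (fun y => ⟪v y, y⟫ • y) x =
      3 * ⟪v x, x⟫ + fderiv ℝ (fun y => ⟪v y, y⟫) x x := by
    rw [divergence_smul_apply (hhd x) differentiableAt_fun_id, h3,
      real_inner_comm (gradient (fun y => ⟪v y, y⟫) x) x, gradient,
      InnerProductSpace.toDual_symm_apply]
    ring
  have hfun : (fun y => ‖y‖ ^ 2 • v y) = fun y => ⟪v y, y⟫ • y := funext hrad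
  rw [hfun, h2] at h1
  linarith

/-- **A `C¹` divergence-free radial vector field on `ℝ³` is identically zero**: with `h = ⟪v, x⟫`,
`r ↦ r h(r y)` has zero derivative (Euler identity) and vanishes at `r = 0`, so `h ≡ 0`,
`‖x‖² v(x) = 0`, and `v(0) = 0` by continuity. [folklore] -/
theorem eq_zero_of_radial_of_isDivFree (hv : ContDiff ℝ 1 v) (hdiv : VectorCalculus.IsDivFree v)
    (hrad : ∀ x, ‖x‖ ^ 2 • v x = ⟪v x, x⟫ • x) (x : EuclideanSpace ℝ (Fin 3)) : v x = 0 := by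
  have hvd : Differentiable ℝ v := hv.differentiable one_ne_zero
  have hhd : Differentiable ℝ (fun y => ⟪v y, y⟫) := hvd.inner ℝ differentiable_id
  have hE : ∀ z, fderiv ℝ (fun y => ⟪v y, y⟫) z z = -⟪v z, z⟫ :=
    fderiv_inner_self_apply_self_of_radial hv hdiv hrad
  -- `⟪v y, y⟫ = 0` everywhere: integrate along the ray through `y`
  have hzero : ∀ y, ⟪v y, y⟫ = 0 := by
    intro y
    have hline : ∀ r : ℝ,
        HasDerivAt (fun r : ℝ => ⟪v (r • y), r • y⟫) (fderiv ℝ (fun z => ⟪v z, z⟫) (r • y) y) r := by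
      intro r
      have h1 : HasDerivAt (fun r : ℝ => r • y) y r := by
        simpa using (hasDerivAt_id r).smul_const y
      exact (hhd (r • y)).hasFDerivAt.comp_hasDerivAt r h1
    have hk : ∀ r : ℝ, HasDerivAt (fun r : ℝ => r * ⟪v (r • y), r • y⟫) 0 r := by
      intro r
      have h2 : HasDerivAt (fun r : ℝ => r * ⟪v (r • y), r • y⟫)
          (1 * ⟪v (r • y), r • y⟫ + r * fderiv ℝ (fun z => ⟪v z, z⟫) (r • y) y) r :=
        (hasDerivAt_id' r).fun_mul (hline r)
      have h3 : r * fderiv ℝ (fun z => ⟪v z, z⟫) (r • y) y = -⟪v (r • y), r • y⟫ := by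
        rw [← hE (r • y), map_smul, smul_eq_mul]
      refine h2.congr_deriv ?_
      rw [one_mul, h3]
      ring
    have hdiff : Differentiable ℝ (fun r : ℝ => r * ⟪v (r • y), r • y⟫) := fun r =>
      (hk r).differentiableAt
    have hderiv : ∀ r, deriv (fun r : ℝ => r * ⟪v (r • y), r • y⟫) r = 0 := fun r => (hk r).deriv
    simpa using is_const_of_deriv_eq_zero hdiff hderiv 1 0
  -- off the origin
  have hoff : ∀ z : EuclideanSpace ℝ (Fin 3), z ≠ 0 → v z = 0 := by
    intro z hz
    have h1 : ‖z‖ ^ 2 • v z = 0 := by rw [hrad z, hzero z, zero_smul]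
    exact (smul_eq_zero.1 h1).resolve_left (pow_ne_zero 2 (norm_ne_zero_iff.2 hz))
  by_cases hx : x = 0
  · -- at the origin: approach along the ray through `e₀ = (1, 0, 0)`
    subst hx
    set y₀ : EuclideanSpace ℝ (Fin 3) := EuclideanSpace.single 0 1 with hy₀_def
    have hy₀ : y₀ ≠ 0 := by
      intro h0
      have h1 := congrArg (fun w => ‖w‖) h0
      simp [hy₀_def] at h1
    have hc : Continuous (fun r : ℝ => v (r • y₀)) :=
      hv.continuous.comp (continuous_id.smul continuous_const)
    have hg : Tendsto (fun r : ℝ => v (r • y₀)) (𝓝[≠] 0) (𝓝 (v 0)) := by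
      simpa using (hc.tendsto 0).mono_left nhdsWithin_le_nhds
    have hg0 : Tendsto (fun r : ℝ => v (r • y₀)) (𝓝[≠] 0) (𝓝 0) :=
      tendsto_const_nhds.congr' (eventually_nhdsWithin_of_forall fun r hr =>
        (hoff (r • y₀) (smul_ne_zero hr hy₀)).symm)
    exact tendsto_nhds_unique hg hg0
  · exact hoff x hx

/-! ### §2 Decaying divergence-free fields parallel to one line vanish -/

/-- Iterating a translation-monotone norm: `‖v x‖ ≤ ‖v (x + n e)‖`. [folklore] -/
theorem norm_le_norm_add_nat_smul (hmono : ∀ x, ‖v x‖ ≤ ‖v (x + e)‖)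
    (x : EuclideanSpace ℝ (Fin 3)) (n : ℕ) : ‖v x‖ ≤ ‖v (x + (n : ℝ) • e)‖ := by
  induction n with
  | zero => simp
  | succ n ih =>
    refine ih.trans ?_
    have h := hmono (x + (n : ℝ) • e)
    rwa [add_assoc, show (n : ℝ) • e + e = ((n + 1 : ℕ) : ℝ) • e by
      rw [Nat.cast_succ, add_smul, one_smul]] at h

/-- **Type-I slice decay kills every field whose norm does not decrease under a non-zero
translation**: `‖v x‖ ≤ C/(‖x‖ + a)` (`a > 0`) and `‖v x‖ ≤ ‖v (x + e)‖` (`e ≠ 0`) give `v ≡ 0`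
(the orbit `x + n e` runs to infinity, where the envelope is below `‖v x‖`).  The `S = 1` case of
KJ-58's screw lemma, re-proved so that this module imports no route file. [folklore] -/
theorem eq_zero_of_decay_of_norm_le_norm_translate {C a : ℝ} (ha : 0 < a)
    (hdec : ∀ x, ‖v x‖ ≤ C / (‖x‖ + a)) (he : e ≠ 0) (hmono : ∀ x, ‖v x‖ ≤ ‖v (x + e)‖)
    (x : EuclideanSpace ℝ (Fin 3)) : v x = 0 := by
  by_contra hx
  have hε : 0 < ‖v x‖ := norm_pos_iff.2 hx
  have he' : 0 < ‖e‖ := norm_pos_iff.2 he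
  obtain ⟨n, hn⟩ := exists_nat_gt ((C / ‖v x‖ + ‖x‖) / ‖e‖)
  have hvy : ‖v x‖ ≤ ‖v (x + (n : ℝ) • e)‖ := norm_le_norm_add_nat_smul hmono x n
  -- the orbit point is far out: `n‖e‖ − ‖x‖ ≤ ‖x + n e‖`
  have hyn : (n : ℝ) * ‖e‖ - ‖x‖ ≤ ‖x + (n : ℝ) • e‖ := by
    have h1 : ‖(n : ℝ) • e‖ ≤ ‖x + (n : ℝ) • e‖ + ‖x‖ := by
      simpa using norm_sub_le (x + (n : ℝ) • e) x
    rw [norm_smul, Real.norm_natCast] at h1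
    linarith
  have hya : 0 < ‖x + (n : ℝ) • e‖ + a := by positivity
  have h4 : C / ‖v x‖ < ‖x + (n : ℝ) • e‖ + a := by
    have := (div_lt_iff₀ he').1 hn
    linarith
  have h5 : C < ‖v x‖ * (‖x + (n : ℝ) • e‖ + a) := by
    have := (div_lt_iff₀ hε).1 h4
    linarith
  have h6 : C / (‖x + (n : ℝ) • e‖ + a) < ‖v x‖ := (div_lt_iff₀ hya).2 h5
  exact absurd (hvy.trans (hdec _)) (not_le.2 h6)

/-- **A `C²` divergence-free field on `ℝ³` everywhere parallel to a fixed `e ≠ 0`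
(`‖e‖² v(x) = ⟪v(x), e⟫ e`) with Type-I slice decay is identically zero**: `∂ₑ⟪v, e⟫ = div v = 0`
makes `v` invariant under the translation by `e` (`eq_of_parallel_of_isDivFree`), and the decay
kills it. [folklore] -/
theorem eq_zero_of_unidirectional_of_isDivFree_of_decay {C a : ℝ} (ha : 0 < a)
    (hdec : ∀ x, ‖v x‖ ≤ C / (‖x‖ + a)) (hv : ContDiff ℝ 2 v) (hdiv : VectorCalculus.IsDivFree v)
    (he : e ≠ 0) (huni : ∀ x, ‖e‖ ^ 2 • v x = ⟪v x, e⟫ • e) (x : EuclideanSpace ℝ (Fin 3)) :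
    v x = 0 := by
  have he2 : ‖e‖ ^ 2 ≠ 0 := pow_ne_zero 2 (norm_ne_zero_iff.2 he)
  have hpar : ∀ y, ∃ a : ℝ, v y = a • e := fun y =>
    ⟨‖e‖⁻¹ ^ 2 * ⟪v y, e⟫, by
      rw [mul_smul, ← huni y, smul_smul, ← mul_pow, inv_mul_cancel₀ (norm_ne_zero_iff.2 he),
        one_pow, one_smul]⟩
  refine eq_zero_of_decay_of_norm_le_norm_translate ha hdec he (fun y => ?_) x
  have h1 := eq_of_parallel_of_isDivFree hv hdiv he hpar y 1
  rw [one_smul] at h1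
  rw [h1]

end Kinematics

/-! ### §3a Rung profiles and window profiles: no radial slice -/

section Profiles

variable {L : ℕ} {C₀ cmin cmax δ ε c : ℝ}
  {R : EuclideanSpace ℝ (Fin 3) ≃ₗᵢ[ℝ] EuclideanSpace ℝ (Fin 3)}
  {u : ℝ → EuclideanSpace ℝ (Fin 3) → EuclideanSpace ℝ (Fin 3)}
  {p : ℝ → EuclideanSpace ℝ (Fin 3) → ℝ}
  {d : ℝ → EuclideanSpace ℝ (Fin 3) → EuclideanSpace ℝ (Fin 3)}

/-- **A radial rung-profile slice is `≡ 0`** (it is `C^∞` and divergence free; §1).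
[cite: MajdaBertozziCUP2002, §1.1 (divergence, incompressibility)] -/
theorem rungProfile_slice_eq_zero_of_radial (hP : IsRungProfile L C₀ c R u p d) {t : ℝ}
    (ht : t < 0) (hrad : ∀ x, ‖x‖ ^ 2 • u t x = ⟪u t x, x⟫ • x) : ∀ x, u t x = 0 :=
  eq_zero_of_radial_of_isDivFree
    ((hP.classical.smooth_velocity.contDiff_slice (mem_Iio.2 ht)).of_le (by norm_cast))
    (hP.classical.divFree t (mem_Iio.2 ht)) hrad

/-- **K1's witnesses are nowhere-in-time radial**: a rung profile all of whose slices are radial is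
trivial (`u ≡ 0` on `t < 0`). [cite: MajdaBertozziCUP2002, §1.1 (divergence, incompressibility)] -/
theorem not_nontrivial_rungProfile_of_radial (hP : IsRungProfile L C₀ c R u p d)
    (hrad : ∀ t < 0, ∀ x, ‖x‖ ^ 2 • u t x = ⟪u t x, x⟫ • x) : ¬ ∃ t < 0, ∃ x, u t x ≠ 0 := by
  rintro ⟨t, ht, x, hx⟩
  exact hx (rungProfile_slice_eq_zero_of_radial hP ht (hrad t ht) x)

/-- **No window profile has a radial slice at `t = −1`** (the floor `δ ≤ ‖u(−1, x₀)‖`, `0 < δ`).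
[cite: MajdaBertozziCUP2002, §1.1 (divergence, incompressibility)] -/
theorem no_windowProfile_radialSlice (hδ : 0 < δ)
    (hW : IsWindowProfile L C₀ cmin cmax δ ε c R u p d)
    (hrad : ∀ x, ‖x‖ ^ 2 • u (-1) x = ⟪u (-1) x, x⟫ • x) : False := by
  obtain ⟨x₀, hx₀⟩ := hW.2.2.2.1
  have hz := rungProfile_slice_eq_zero_of_radial hW.1 (by norm_num) hrad x₀
  rw [hz, norm_zero] at hx₀
  exact absurd hx₀ (not_le.2 hδ)

end Profiles

/-! ### §3b Window sequences: strata (S33), (S34) -/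

section Sequences

variable {C₀ cmin cmax δ : ℝ} {L : ℕ → ℕ} {ε c : ℕ → ℝ}
  {R : ℕ → (EuclideanSpace ℝ (Fin 3) ≃ₗᵢ[ℝ] EuclideanSpace ℝ (Fin 3))}
  {u : ℕ → ℝ → EuclideanSpace ℝ (Fin 3) → EuclideanSpace ℝ (Fin 3)}
  {p : ℕ → ℝ → EuclideanSpace ℝ (Fin 3) → ℝ}
  {d : ℕ → ℝ → EuclideanSpace ℝ (Fin 3) → EuclideanSpace ℝ (Fin 3)}

/-- **(S33) NO ADMISSIBLE WINDOW SEQUENCE IS ASYMPTOTICALLY RADIAL.** If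
`‖x‖² uₙ(−1, x) − ⟪uₙ(−1, x), x⟫ x → 0` for every `x`, the ladder limit (`exists_ladderLimit_typeI`)
has a radial, `C^∞`, divergence-free slice `v(−1)`, hence `v(−1) ≡ 0` (§1) — contradicting the
inherited floor `δ ≤ ‖v(−1, x₀)‖`. [cite: KochNadirashviliSereginSverak2009, Lemma 6.1 (limits of rescaled solutions)] -/
theorem no_windowSequence_asymptoticallyRadial (hcmin : 1 < cmin) (hδ : 0 < δ)
    (hε : Tendsto ε atTop (𝓝 0))
    (hW : ∀ n, IsWindowProfile (L n) C₀ cmin cmax δ (ε n) (c n) (R n) (u n) (p n) (d n))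
    (hrad : ∀ x, Tendsto (fun n => ‖x‖ ^ 2 • u n (-1) x - ⟪u n (-1) x, x⟫ • x) atTop (𝓝 0)) :
    False := by
  obtain ⟨φ, c', R', v, hφ, -, -, -, hptw, -, -, -, hmild, -, -, -, ⟨x₀, hx₀⟩, -⟩ :=
    exists_ladderLimit_typeI hcmin hδ hε hW
  have h1 : (-1 : ℝ) < 0 := by norm_num
  have hlim : ∀ x, ‖x‖ ^ 2 • v (-1) x = ⟪v (-1) x, x⟫ • x := by
    intro x
    have ht : Tendsto (fun n => ‖x‖ ^ 2 • u (φ n) (-1) x - ⟪u (φ n) (-1) x, x⟫ • x) atTop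
        (𝓝 (‖x‖ ^ 2 • v (-1) x - ⟪v (-1) x, x⟫ • x)) :=
      ((hptw (-1) h1 x).const_smul _).sub
        ((Filter.Tendsto.inner (𝕜 := ℝ) (hptw (-1) h1 x) tendsto_const_nhds).smul_const x)
    exact sub_eq_zero.1 (tendsto_nhds_unique ht ((hrad x).comp hφ.tendsto_atTop))
  have hz : v (-1) x₀ = 0 :=
    eq_zero_of_radial_of_isDivFree ((hmild.contDiff_slice h1).of_le (by norm_cast))
      (hmild.isDivFree h1) hlim x₀
  rw [hz, norm_zero] at hx₀
  exact absurd hx₀ (not_le.2 hδ)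

/-- **(S34) NO ADMISSIBLE WINDOW SEQUENCE IS ASYMPTOTICALLY UNIDIRECTIONAL.** For a fixed `e ≠ 0`:
if `‖e‖² uₙ(−1, x) − ⟪uₙ(−1, x), e⟫ e → 0` for every `x`, the limit slice `v(−1)` is parallel to
`ℝe`, `C^∞`, divergence free and Type-I decaying (`C₀/(‖x‖ + 1)`), hence `≡ 0` (§2) — contradicting
the floor. [cite: KochNadirashviliSereginSverak2009, Lemma 6.1 (limits of rescaled solutions), (1.6) (Type-I decay)] -/
theorem no_windowSequence_asymptoticallyUnidirectional {e : EuclideanSpace ℝ (Fin 3)} (he : e ≠ 0)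
    (hcmin : 1 < cmin) (hδ : 0 < δ) (hε : Tendsto ε atTop (𝓝 0))
    (hW : ∀ n, IsWindowProfile (L n) C₀ cmin cmax δ (ε n) (c n) (R n) (u n) (p n) (d n))
    (huni : ∀ x, Tendsto (fun n => ‖e‖ ^ 2 • u n (-1) x - ⟪u n (-1) x, e⟫ • e) atTop (𝓝 0)) :
    False := by
  obtain ⟨φ, c', R', v, hφ, -, -, -, hptw, -, -, -, hmild, -, -, hTI, ⟨x₀, hx₀⟩, -⟩ :=
    exists_ladderLimit_typeI hcmin hδ hε hW
  have h1 : (-1 : ℝ) < 0 := by norm_num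
  have hlim : ∀ x, ‖e‖ ^ 2 • v (-1) x = ⟪v (-1) x, e⟫ • e := by
    intro x
    have ht : Tendsto (fun n => ‖e‖ ^ 2 • u (φ n) (-1) x - ⟪u (φ n) (-1) x, e⟫ • e) atTop
        (𝓝 (‖e‖ ^ 2 • v (-1) x - ⟪v (-1) x, e⟫ • e)) :=
      ((hptw (-1) h1 x).const_smul _).sub
        ((Filter.Tendsto.inner (𝕜 := ℝ) (hptw (-1) h1 x) tendsto_const_nhds).smul_const e)
    exact sub_eq_zero.1 (tendsto_nhds_unique ht ((huni x).comp hφ.tendsto_atTop))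
  have hdec : ∀ x, ‖v (-1) x‖ ≤ C₀ / (‖x‖ + 1) := fun x => by
    simpa using hTI (-1) h1 x
  have hz : v (-1) x₀ = 0 :=
    eq_zero_of_unidirectional_of_isDivFree_of_decay one_pos hdec
      ((hmild.contDiff_slice h1).of_le (by norm_cast)) (hmild.isDivFree h1) he hlim x₀
  rw [hz, norm_zero] at hx₀
  exact absurd hx₀ (not_le.2 hδ)

/-- **(S33), census form**: not asymptotically radial on `t < 0`.
[cite: KochNadirashviliSereginSverak2009, Lemma 6.1 (limits of rescaled solutions)] -/
theorem no_windowSequence_asymptoticallyRadial_census (hcmin : 1 < cmin) (hδ : 0 < δ)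
    (hε : Tendsto ε atTop (𝓝 0))
    (hW : ∀ n, IsWindowProfile (L n) C₀ cmin cmax δ (ε n) (c n) (R n) (u n) (p n) (d n)) :
    ¬ (∀ t < 0, ∀ x, Tendsto (fun n => ‖x‖ ^ 2 • u n t x - ⟪u n t x, x⟫ • x) atTop (𝓝 0)) :=
  fun hrad => no_windowSequence_asymptoticallyRadial hcmin hδ hε hW (hrad (-1) (by norm_num))

/-- **(S34), census form**: not asymptotically unidirectional along any fixed `e ≠ 0` on `t < 0`.
[cite: KochNadirashviliSereginSverak2009, Lemma 6.1 (limits of rescaled solutions)] -/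
theorem no_windowSequence_asymptoticallyUnidirectional_census (hcmin : 1 < cmin) (hδ : 0 < δ)
    (hε : Tendsto ε atTop (𝓝 0))
    (hW : ∀ n, IsWindowProfile (L n) C₀ cmin cmax δ (ε n) (c n) (R n) (u n) (p n) (d n)) :
    ¬ ∃ e : EuclideanSpace ℝ (Fin 3), e ≠ 0 ∧
        ∀ t < 0, ∀ x, Tendsto (fun n => ‖e‖ ^ 2 • u n t x - ⟪u n t x, e⟫ • e) atTop (𝓝 0) :=
  fun ⟨_, he, huni⟩ =>
    no_windowSequence_asymptoticallyUnidirectional he hcmin hδ hε hW (huni (-1) (by norm_num))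

end Sequences

end Summit.NavierStokesRegularity.AngularGalerkinLadderRadialUnidirectionalLimitsExcluded

end
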